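import Literature.AlgebraicGeometry.ShimuraVarieties.UnitaryBallConeCotangentForms
import HarnessLib

/-!
# Holomorphic forms of a compact ball quotient evaluate holomorphically along the cone uniformisation

Topic `AlgebraicGeometry/ShimuraVarieties`; namespace
`Literature.AlgebraicGeometry.ShimuraVarieties.UnitaryBallUniformisationDatum` (datum-dotted). THEOREMS ONLY: no
definition, no named fact, no instance, no notation, no `sorry`; imports = tree only.

Let `D : UnitaryBallUniformisationDatum p X` be a ball uniformisation of the smooth projective variety `X / ℂ`, read on
the negative cone `D.cone ⊆ ℂ^{p+1}` of its hermitian form, and `A : HodgeModel p X` a Hodge model (the complex manifold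
`X^an`), so that `ψ = (X^an ≃ X(ℂ))⁻¹ ∘ unif : D.cone → X^an` is holomorphic (★ `mdifferentiableAt_symm_comp_unif_of_mem_cone`,
`UnitaryBallConeFormPullback` §1). For a complex `k`-form `η` on `X^an` which is **holomorphic in charts**
(`Literature.Geometry.Kaehler.IsHolomorphicInCharts`: near the centre of the preferred chart at each point, the chart
representative of `η` is the restriction of scalars of a complex-analytic germ of `ℂ`-multilinear alternating forms) we
prove — the cone analogue, in every rank `p`, of ★ `differentiableAt_mform_unifDeriv` (`UnitaryBallHolomorphicPullback`,
ball model, `p = 2`):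

* `differentiableAt_mform_coneDeriv_prod` — the evaluation `(u, t) ↦ η_{ψ u}(dψ_u t₁, …, dψ_u t_k)` is complex-differentiable,
  JOINTLY in the cone point `u` and the tangent vectors `t = (t₁, …, t_k) ∈ (ℂ^{p+1})^k`, at every point of
  `D.cone × (ℂ^{p+1})^k`. Proof: in the chart `c` of `X^an` at `x = ψ u₀`, with `Y = c ∘ ψ` (holomorphic near `u₀`), the real
  chain rule `dψ_u = d(c⁻¹)_{Y u} ∘ dY_u` identifies the function near `(u₀, t)` with `(u, t) ↦ g(Y u)(dY_u t₁, …, dY_u t_k)`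
  for the analytic germ `g` representing `η`; the derivative `u ↦ dY_u` of the holomorphic map `Y` is holomorphic with values
  in continuous linear maps (Osgood: holomorphic ⇒ `C^∞`, ★ `SCV.contDiffOn_infty`), evaluation `(L, t) ↦ L t` and evaluation
  of a continuous alternating map on a tuple are differentiable (Voisin I §2.2.1–§2.3.1; Huybrechts Def. 2.2.14);
* `differentiableAt_mform_coneDeriv` — for constant vectors `v₁, …, v_k`, `u ↦ η_{ψ u}(dψ_u v₁, …, dψ_u v_k)` is
  complex-differentiable at every cone point (the literal cone analogue of ★ `differentiableAt_mform_unifDeriv`);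
* `differentiableAt_mform_coneDeriv_mulVec`, `differentiableOn_mform_coneDeriv_mulVec` — **holomorphy in the group
  variable**: for `v₀, t₁, …, t_k ∈ ℂ^{p+1}` the function `g ↦ η_{ψ(g v₀)}(dψ_{g v₀}(g t₁), …, dψ_{g v₀}(g t_k))` of the matrix
  `g` is complex-differentiable at every `g` with `g v₀ ∈ D.cone`, hence `DifferentiableOn ℂ` on the cone-open
  `{g | g v₀ ∈ D.cone}` of `M_{p+1}(ℂ) = ℂ^{(p+1)²}` (composition with the `ℂ`-linear map `g ↦ (g v₀, (g tᵢ)ᵢ)`). This is the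
  holomorphy clause of the «cone reading» of holomorphic cotangent automorphic forms (Borel (1997) §5.14: a holomorphic
  differential read on the group is a holomorphic automorphic form; Bergeron–Millson–Moeglin (2016), Part 2 §1.3, the cone
  over the ball). The matrix variable is typed `Fin (p + 1) → Fin (p + 1) → ℂ` and read through `Matrix.of` (the `Pi` normed space
  underlying `Matrix (Fin (p + 1)) (Fin (p + 1)) ℂ`, whose elementwise norm `Matrix.normedAddCommGroup` is this `Pi` norm by
  definition), so that `DifferentiableOn ℂ` needs no scoped matrix-norm instance — the currency of the holomorphy clause of the
  cone carriers of holomorphic cotangent forms; `isOpen_setOf_mulVec_mem_cone` records that the cone-open is open, and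
  `differentiableOn_mform₁_coneDeriv_mulVec` is the `1`-form, one-vector instance on `{g | IsUnit g ∧ g v₀ ∈ D.cone}`;
* `mform₁_coneDeriv_mul_of_mulVec_eq_smul` — the companion **cotangent law in the group variable**: if `b v₀ = k v₀` (`k ≠ 0`)
  and `b t₀ = a t₀ + d v₀` then `Φ(g b) = (a k⁻¹) · Φ(g)` for the cone pull-back `Φ(g) = α_{ψ(g v₀)}(dψ_{g v₀}(g t₀))` of a
  `ℂ`-linear `1`-form `α` at every `g` with `g v₀ ∈ D.cone` — the matrix reading of ★ `conePullback_of_smul_eq`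
  (`UnitaryBallConeCotangentForms`; Borel (1997) §5.13–§5.14: the `K_∞`-type of the cotangent line). Together the last two are
  the two clauses («holomorphic on the cone-open», «law along the stabiliser of `ℂ v₀`») of the cone carrier of holomorphic
  cotangent automorphic forms, for the cone pull-back of a holomorphic `1`-form.

References: C. Voisin, *Hodge Theory and Complex Algebraic Geometry I* (2002), §2.2.1 (holomorphic maps have `ℂ`-linear,
holomorphically varying differentials), §2.3.1 (holomorphic forms in holomorphic coordinates); D. Huybrechts, *Complex
Geometry* (2005), Def. 2.2.14; A. Borel, *Automorphic forms on `SL₂(ℝ)`* (1997), §5.14; N. Bergeron, J. Millson,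
C. Moeglin, *The Hodge conjecture and arithmetic quotients of complex balls* (2016), Part 2 §1.3.
-/

noncomputable section

open Matrix Function Set Filter
open scoped Manifold Topology ContDiff
open Literature.Geometry.ComplexHyperbolic
open Literature.Geometry.Kaehler (MForm IsHolomorphicInCharts holFormsInCharts)
open Literature.NumberTheory.Transcendental
open Literature.AlgebraicGeometry.HodgeTheory (HodgeModel)
open Literature.Analysis.Complex

namespace Literature.AlgebraicGeometry.ShimuraVarieties

namespace UnitaryBallUniformisationDatum

variable {p : ℕ} {X : Motives.SchemeOver ℂ} (D : UnitaryBallUniformisationDatum p X) (A : HodgeModel p X)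

/-! ### §1 Joint holomorphy of `(u, t) ↦ η_{ψ u}(dψ_u t₁, …, dψ_u t_k)` on `D.cone × (ℂ^{p+1})^k` -/

/-- **Holomorphic forms evaluate holomorphically along the cone uniformisation, jointly in point and vectors.** If `η` is a
complex `k`-form on `X^an` holomorphic in charts, then `(u, t) ↦ η_{ψ u}(dψ_u t₁, …, dψ_u t_k)` (`ψ = (X^an ≃ X(ℂ))⁻¹ ∘ unif`) is
complex-differentiable at every point `(u₀, t)` with `u₀ ∈ D.cone`. In the chart `c` at `ψ u₀`, with `Y = c ∘ ψ`, the function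
is `g(Y u)(dY_u t₁, …, dY_u t_k)` near `(u₀, t)` for the analytic germ `g` representing `η`, and `u ↦ dY_u` is holomorphic.
[cite: VoisinHodgeI2002, §2.2.1 and §2.3.1] -/
theorem differentiableAt_mform_coneDeriv_prod {k : ℕ} {η : MForm 𝓘(ℝ, A.model) A.carrier ℂ k}
    (hη : IsHolomorphicInCharts η) {z : Fin (p + 1) → ℂ} (hz : z ∈ D.cone) (t : Fin k → (Fin (p + 1) → ℂ)) :
    DifferentiableAt ℂ
      (fun q : (Fin (p + 1) → ℂ) × (Fin k → (Fin (p + 1) → ℂ)) ↦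
        η ((⇑A.isAnalytification.homeomorph.symm ∘ D.unif) q.1) fun i ↦
          mfderiv 𝓘(ℝ, Fin (p + 1) → ℂ) 𝓘(ℝ, A.model) (⇑A.isAnalytification.homeomorph.symm ∘ D.unif) q.1 (q.2 i))
      (z, t) := by
  set ψ : (Fin (p + 1) → ℂ) → A.carrier := ⇑A.isAnalytification.homeomorph.symm ∘ D.unif with hψ
  -- the chart at `x = ψ z` and the composite `Y = c ∘ ψ`
  set x : A.carrier := ψ z with hx
  set Y : (Fin (p + 1) → ℂ) → A.model := fun w ↦ extChartAt 𝓘(ℝ, A.model) x (ψ w) with hY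
  -- the open set of cone points mapped into the chart domain
  set O : Set (Fin (p + 1) → ℂ) := D.cone ∩ ψ ⁻¹' (chartAt A.model x).source with hO
  have hOo : IsOpen O :=
    (D.continuousOn_symm_comp_unif A).isOpen_inter_preimage (isOpen_negCone _) (chartAt A.model x).open_source
  have hzO : z ∈ O := ⟨hz, mem_chart_source _ x⟩
  have hsrc : ∀ w ∈ O, ψ w ∈ (extChartAt 𝓘(ℝ, A.model) x).source := fun w hw ↦ by
    rw [extChartAt_source]; exact hw.2
  have htgt : ∀ w ∈ O, Y w ∈ (extChartAt 𝓘(ℝ, A.model) x).target := fun w hw ↦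
    (extChartAt 𝓘(ℝ, A.model) x).map_source (hsrc w hw)
  have hleft : ∀ w ∈ O, (extChartAt 𝓘(ℝ, A.model) x).symm (Y w) = ψ w := fun w hw ↦
    (extChartAt 𝓘(ℝ, A.model) x).left_inv (hsrc w hw)
  -- `Y` is holomorphic on `O` (holomorphic chart after the holomorphic uniformisation)
  have hYd : DifferentiableOn ℂ Y O := fun w hw ↦ by
    have h1 : MDifferentiableAt 𝓘(ℂ, Fin (p + 1) → ℂ) 𝓘(ℂ, A.model) ψ w :=
      D.mdifferentiableAt_symm_comp_unif_of_mem_cone A hw.1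
    have h2 : MDifferentiableAt 𝓘(ℂ, A.model) 𝓘(ℂ, A.model) (extChartAt 𝓘(ℂ, A.model) x) (ψ w) :=
      mdifferentiableAt_extChartAt hw.2
    exact (mdifferentiableAt_iff_differentiableAt.1 (h2.comp w h1)).differentiableWithinAt
  -- its derivative `u ↦ dY_u` is holomorphic (Osgood), with values in continuous linear maps
  have hYd' : DifferentiableOn ℂ (fderiv ℂ Y) O :=
    ((SCV.contDiffOn_infty hYd hOo).fderiv_of_isOpen hOo (m := ∞) (by simp)).differentiableOn (by simp)
  -- the real chain rule `dψ_w = d(c⁻¹)_{Y w} ∘ dY_w` on `O`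
  have hder : ∀ w ∈ O, mfderiv 𝓘(ℝ, Fin (p + 1) → ℂ) 𝓘(ℝ, A.model) ψ w =
      (mfderivWithin 𝓘(ℝ, A.model) 𝓘(ℝ, A.model) (extChartAt 𝓘(ℝ, A.model) x).symm
        (range 𝓘(ℝ, A.model)) (Y w)).comp (fderiv ℝ Y w) := fun w hw ↦ by
    have hYw : DifferentiableAt ℂ Y w := hYd.differentiableAt (hOo.mem_nhds hw)
    have h1 : HasMFDerivAt 𝓘(ℝ, Fin (p + 1) → ℂ) 𝓘(ℝ, A.model) Y w (fderiv ℝ Y w) :=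
      hasMFDerivAt_iff_hasFDerivAt.2 (hYw.restrictScalars ℝ).hasFDerivAt
    have h2 : HasMFDerivAt 𝓘(ℝ, A.model) 𝓘(ℝ, A.model) (extChartAt 𝓘(ℝ, A.model) x).symm
        (Y w) (mfderivWithin 𝓘(ℝ, A.model) 𝓘(ℝ, A.model) (extChartAt 𝓘(ℝ, A.model) x).symm
          (range 𝓘(ℝ, A.model)) (Y w)) :=
      (mdifferentiableWithinAt_extChartAt_symm (htgt w hw)).hasMFDerivWithinAt.hasMFDerivAt
        (by rw [ModelWithCorners.Boundaryless.range_eq_univ]; exact univ_mem)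
    have hev : ψ =ᶠ[𝓝 w] (extChartAt 𝓘(ℝ, A.model) x).symm ∘ Y := by
      filter_upwards [hOo.mem_nhds hw] with w' hw'
      exact (hleft w' hw').symm
    exact ((h2.comp w h1).congr_of_eventuallyEq hev).mfderiv
  -- hence the pulled-back form is the chart representative evaluated on the vectors `dY_w sᵢ`
  have hform : ∀ w ∈ O, ∀ s : Fin k → (Fin (p + 1) → ℂ),
      η (ψ w) (fun i ↦ mfderiv 𝓘(ℝ, Fin (p + 1) → ℂ) 𝓘(ℝ, A.model) ψ w (s i)) =
        η.inChart x (Y w) fun i ↦ fderiv ℝ Y w (s i) := fun w hw s ↦ by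
    have key : ∀ {a b : A.carrier} (r : Fin k → A.model), a = b → η a r = η b r := by
      rintro a b r rfl; rfl
    rw [Literature.Geometry.Kaehler.MForm.inChart_apply]
    simp only [hder w hw]
    exact key _ (hleft w hw).symm
  -- the analytic germ representing `η` in the chart at `x`
  obtain ⟨g, hg, heq⟩ := hη x
  have hYz : extChartAt 𝓘(ℝ, A.model) x x = Y z := rfl
  rw [hYz] at hg heq
  have hYc : ContinuousAt Y z := (hYd.differentiableAt (hOo.mem_nhds hzO)).continuousAt
  -- near `(z, t)` the function is `(u, s) ↦ g (Y u) (dY_u s₁, …, dY_u s_k)`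
  have hnear : ∀ᶠ w in 𝓝 z, w ∈ O ∧ η.inChart x (Y w) = (g (Y w)).restrictScalars ℝ := by
    filter_upwards [hOo.mem_nhds hzO, hYc.tendsto.eventually heq] with w hw hw'
    exact ⟨hw, hw'⟩
  have hev : (fun q : (Fin (p + 1) → ℂ) × (Fin k → (Fin (p + 1) → ℂ)) ↦
        η (ψ q.1) fun i ↦ mfderiv 𝓘(ℝ, Fin (p + 1) → ℂ) 𝓘(ℝ, A.model) ψ q.1 (q.2 i)) =ᶠ[𝓝 (z, t)]
      fun q ↦ g (Y q.1) fun i ↦ fderiv ℂ Y q.1 (q.2 i) := by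
    filter_upwards [hnear.prod_inl_nhds t] with q hq
    simp only [hform q.1 hq.1, hq.2, ContinuousAlternatingMap.coe_restrictScalars,
      (hYd.differentiableAt (hOo.mem_nhds hq.1)).fderiv_restrictScalars (𝕜 := ℝ),
      ContinuousLinearMap.coe_restrictScalars']
  -- differentiability of `(u, s) ↦ g (Y u) (dY_u s₁, …, dY_u s_k)` at `(z, t)`
  have hfst : DifferentiableAt ℂ
      (Prod.fst : (Fin (p + 1) → ℂ) × (Fin k → (Fin (p + 1) → ℂ)) → Fin (p + 1) → ℂ) (z, t) :=
    differentiableAt_fst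
  have hsnd : DifferentiableAt ℂ
      (Prod.snd : (Fin (p + 1) → ℂ) × (Fin k → (Fin (p + 1) → ℂ)) → Fin k → (Fin (p + 1) → ℂ)) (z, t) :=
    differentiableAt_snd
  have h1 := (hYd.differentiableAt (hOo.mem_nhds hzO)).comp (z, t) hfst
  have h2 := hg.differentiableAt.comp (z, t) h1
  have h3 := (hYd'.differentiableAt (hOo.mem_nhds hzO)).comp (z, t) hfst
  have h4 : ∀ i, DifferentiableAt ℂ
      (fun q : (Fin (p + 1) → ℂ) × (Fin k → (Fin (p + 1) → ℂ)) ↦ (fderiv ℂ Y ∘ Prod.fst) q (q.2 i)) (z, t) :=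
    fun i ↦ h3.clm_apply (differentiableAt_pi.1 hsnd i)
  have hd := h2.continuousAlternatingMap_apply h4
  exact hd.congr_of_eventuallyEq hev

/-- **Holomorphic forms evaluate holomorphically along the cone uniformisation** (constant vectors): for `η` holomorphic in
charts and `v₁, …, v_k ∈ ℂ^{p+1}`, `u ↦ η_{ψ u}(dψ_u v₁, …, dψ_u v_k)` is complex-differentiable at every cone point — the cone
analogue, in every rank, of ★ `differentiableAt_mform_unifDeriv`. [cite: VoisinHodgeI2002, §2.2.1 and §2.3.1] -/
theorem differentiableAt_mform_coneDeriv {k : ℕ} {η : MForm 𝓘(ℝ, A.model) A.carrier ℂ k}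
    (hη : IsHolomorphicInCharts η) (v : Fin k → (Fin (p + 1) → ℂ)) {z : Fin (p + 1) → ℂ} (hz : z ∈ D.cone) :
    DifferentiableAt ℂ
      (fun w : Fin (p + 1) → ℂ ↦
        η ((⇑A.isAnalytification.homeomorph.symm ∘ D.unif) w) fun i ↦
          mfderiv 𝓘(ℝ, Fin (p + 1) → ℂ) 𝓘(ℝ, A.model) (⇑A.isAnalytification.homeomorph.symm ∘ D.unif) w (v i))
      z := by
  have hzv : DifferentiableAt ℂ (fun w : Fin (p + 1) → ℂ ↦ (w, v)) z :=
    differentiableAt_id.prodMk (differentiableAt_const v)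
  have h := (D.differentiableAt_mform_coneDeriv_prod A hη hz v).comp z hzv
  exact h

/-! ### §2 Holomorphy in the group variable: `g ↦ η_{ψ(g v₀)}(dψ_{g v₀}(g t₁), …, dψ_{g v₀}(g t_k))` -/

/-- The matrix–vector product is complex-differentiable in the matrix (it is `ℂ`-linear; matrices typed as the `Pi` space
`Fin (p + 1) → Fin (p + 1) → ℂ`). [folklore] -/
private theorem differentiableAt_mulVec_const (v : Fin (p + 1) → ℂ) (g : Fin (p + 1) → Fin (p + 1) → ℂ) :
    DifferentiableAt ℂ (fun g' : Fin (p + 1) → Fin (p + 1) → ℂ ↦ Matrix.of g' *ᵥ v) g := by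
  refine differentiableAt_pi.2 fun i ↦ ?_
  simp only [Matrix.mulVec, dotProduct, Matrix.of_apply]
  refine DifferentiableAt.fun_sum fun j _ ↦ ?_
  have hij : DifferentiableAt ℂ (fun g' : Fin (p + 1) → Fin (p + 1) → ℂ ↦ g' i j) g :=
    differentiableAt_pi.1 (differentiableAt_apply i g) j
  exact hij.mul_const _

/-- **The cone-open of the matrix space is open**: `{g | g v₀ ∈ D.cone}` is open in `M_{p+1}(ℂ)` (the cone is open and
`g ↦ g v₀` is continuous). [cite: BergeronMillsonMoeglin2016Balls, Part 2 §1.3] -/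
theorem isOpen_setOf_mulVec_mem_cone (v₀ : Fin (p + 1) → ℂ) :
    IsOpen {g : Fin (p + 1) → Fin (p + 1) → ℂ | Matrix.of g *ᵥ v₀ ∈ D.cone} :=
  (isOpen_negCone _).preimage (Continuous.matrix_mulVec continuous_id continuous_const)

/-- **Holomorphy in the group variable, pointwise.** For `η` holomorphic in charts and `v₀, t₁, …, t_k ∈ ℂ^{p+1}`, the function
`g ↦ η_{ψ(g v₀)}(dψ_{g v₀}(g t₁), …, dψ_{g v₀}(g t_k))` is complex-differentiable at every matrix `g` with `g v₀ ∈ D.cone`: it is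
the composite of the jointly holomorphic evaluation `differentiableAt_mform_coneDeriv_prod` with the `ℂ`-linear map
`g ↦ (g v₀, (g tᵢ)ᵢ)` (a holomorphic differential read on the group is holomorphic). [cite: Borel1997, §5.14] -/
theorem differentiableAt_mform_coneDeriv_mulVec {k : ℕ} {η : MForm 𝓘(ℝ, A.model) A.carrier ℂ k}
    (hη : IsHolomorphicInCharts η) (v₀ : Fin (p + 1) → ℂ) (t : Fin k → (Fin (p + 1) → ℂ))
    {g : Fin (p + 1) → Fin (p + 1) → ℂ} (hg : Matrix.of g *ᵥ v₀ ∈ D.cone) :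
    DifferentiableAt ℂ
      (fun g' : Fin (p + 1) → Fin (p + 1) → ℂ ↦
        η ((⇑A.isAnalytification.homeomorph.symm ∘ D.unif) (Matrix.of g' *ᵥ v₀)) fun i ↦
          mfderiv 𝓘(ℝ, Fin (p + 1) → ℂ) 𝓘(ℝ, A.model) (⇑A.isAnalytification.homeomorph.symm ∘ D.unif)
            (Matrix.of g' *ᵥ v₀) (Matrix.of g' *ᵥ t i))
      g := by
  have h := (D.differentiableAt_mform_coneDeriv_prod A hη hg fun i ↦ Matrix.of g *ᵥ t i).comp g
    ((differentiableAt_mulVec_const v₀ g).prodMk (differentiableAt_pi.2 fun i ↦ differentiableAt_mulVec_const (t i) g))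
  exact h

/-- **Holomorphy in the group variable, on the cone-open.** For `η` holomorphic in charts and `v₀, t₁, …, t_k ∈ ℂ^{p+1}`,
`g ↦ η_{ψ(g v₀)}(dψ_{g v₀}(g t₁), …, dψ_{g v₀}(g t_k))` is `ℂ`-differentiable on the open set `{g | g v₀ ∈ D.cone}` of
`M_{p+1}(ℂ)` — the holomorphy clause of the cone reading of holomorphic cotangent automorphic forms. [cite: Borel1997, §5.14] -/
theorem differentiableOn_mform_coneDeriv_mulVec {k : ℕ} {η : MForm 𝓘(ℝ, A.model) A.carrier ℂ k}
    (hη : IsHolomorphicInCharts η) (v₀ : Fin (p + 1) → ℂ) (t : Fin k → (Fin (p + 1) → ℂ)) :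
    DifferentiableOn ℂ
      (fun g' : Fin (p + 1) → Fin (p + 1) → ℂ ↦
        η ((⇑A.isAnalytification.homeomorph.symm ∘ D.unif) (Matrix.of g' *ᵥ v₀)) fun i ↦
          mfderiv 𝓘(ℝ, Fin (p + 1) → ℂ) 𝓘(ℝ, A.model) (⇑A.isAnalytification.homeomorph.symm ∘ D.unif)
            (Matrix.of g' *ᵥ v₀) (Matrix.of g' *ᵥ t i))
      {g | Matrix.of g *ᵥ v₀ ∈ D.cone} :=
  fun _ hg ↦ (D.differentiableAt_mform_coneDeriv_mulVec A hη v₀ t hg).differentiableWithinAt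

/-- **The holomorphy clause of the cone carrier, literally**: for a `1`-form `η` holomorphic in charts and `v₀, t₀ ∈ ℂ^{p+1}`, the
cone pull-back `g ↦ η_{ψ(g v₀)}(dψ_{g v₀}(g t₀))` is `ℂ`-differentiable on `{g | g invertible, g v₀ ∈ D.cone}` (matrices read through
`Matrix.of`). [cite: Borel1997, §5.14] -/
theorem differentiableOn_mform₁_coneDeriv_mulVec {η : MForm 𝓘(ℝ, A.model) A.carrier ℂ 1} (hη : IsHolomorphicInCharts η)
    (v₀ t₀ : Fin (p + 1) → ℂ) :
    DifferentiableOn ℂ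
      (fun g' : Fin (p + 1) → Fin (p + 1) → ℂ ↦
        η ((⇑A.isAnalytification.homeomorph.symm ∘ D.unif) (Matrix.of g' *ᵥ v₀)) fun _ ↦
          mfderiv 𝓘(ℝ, Fin (p + 1) → ℂ) 𝓘(ℝ, A.model) (⇑A.isAnalytification.homeomorph.symm ∘ D.unif)
            (Matrix.of g' *ᵥ v₀) (Matrix.of g' *ᵥ t₀))
      {g | IsUnit (Matrix.of g) ∧ Matrix.of g *ᵥ v₀ ∈ D.cone} :=
  (D.differentiableOn_mform_coneDeriv_mulVec A hη v₀ fun _ : Fin 1 ↦ t₀).mono fun _ hg ↦ hg.2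

/-! ### §3 The cotangent law in the group variable -/

/-- **The cotangent law of the cone pull-back, in the group variable.** For a `ℂ`-linear `1`-form `α`, `v₀, t₀ ∈ ℂ^{p+1}`, a matrix
`g` with `g v₀ ∈ D.cone` and a matrix `b` with `b v₀ = k • v₀` (`k ≠ 0`) and `b t₀ = a • t₀ + d • v₀`:
`α_{ψ((g b) v₀)}(dψ_{(g b) v₀}((g b) t₀)) = (a k⁻¹) · α_{ψ(g v₀)}(dψ_{g v₀}(g t₀))` — since `(g b) v₀ = k • g v₀` and
`(g b) t₀ = a • g t₀ + d • g v₀`, this is ★ `conePullback_of_smul_eq`. [cite: Borel1997, §5.13–§5.14] -/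
theorem mform₁_coneDeriv_mul_of_mulVec_eq_smul {α : MForm 𝓘(ℝ, A.model) A.carrier ℂ 1} (hα : IsComplexLinearForm α)
    (v₀ t₀ : Fin (p + 1) → ℂ) {g b : Matrix (Fin (p + 1)) (Fin (p + 1)) ℂ} {a k d : ℂ} (hg : g *ᵥ v₀ ∈ D.cone)
    (hk : k ≠ 0) (hb : b *ᵥ v₀ = k • v₀) (hbt : b *ᵥ t₀ = a • t₀ + d • v₀) :
    α ((⇑A.isAnalytification.homeomorph.symm ∘ D.unif) ((g * b) *ᵥ v₀))
        (fun _ ↦ mfderiv 𝓘(ℝ, Fin (p + 1) → ℂ) 𝓘(ℝ, A.model) (⇑A.isAnalytification.homeomorph.symm ∘ D.unif)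
          ((g * b) *ᵥ v₀) ((g * b) *ᵥ t₀)) =
      (a * k⁻¹) * α ((⇑A.isAnalytification.homeomorph.symm ∘ D.unif) (g *ᵥ v₀))
        (fun _ ↦ mfderiv 𝓘(ℝ, Fin (p + 1) → ℂ) 𝓘(ℝ, A.model) (⇑A.isAnalytification.homeomorph.symm ∘ D.unif)
          (g *ᵥ v₀) (g *ᵥ t₀)) := by
  have hku : (g * b) *ᵥ v₀ = k • (g *ᵥ v₀) := by
    rw [← Matrix.mulVec_mulVec, hb, Matrix.mulVec_smul]
  have hkt : (g * b) *ᵥ t₀ = a • (g *ᵥ t₀) + d • (g *ᵥ v₀) := by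
    rw [← Matrix.mulVec_mulVec, hbt, Matrix.mulVec_add, Matrix.mulVec_smul, Matrix.mulVec_smul]
  exact D.conePullback_of_smul_eq A hα hg hk hku hkt

/-- The same law with matrices read through `Matrix.of` on the `Pi` type (the currency of the cone carrier's holomorphy clause).
[cite: Borel1997, §5.13–§5.14] -/
theorem mform₁_coneDeriv_of_mul_of_mulVec_eq_smul {α : MForm 𝓘(ℝ, A.model) A.carrier ℂ 1} (hα : IsComplexLinearForm α)
    (v₀ t₀ : Fin (p + 1) → ℂ) {g b : Fin (p + 1) → Fin (p + 1) → ℂ} {a k d : ℂ} (hg : Matrix.of g *ᵥ v₀ ∈ D.cone)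
    (hk : k ≠ 0) (hb : Matrix.of b *ᵥ v₀ = k • v₀) (hbt : Matrix.of b *ᵥ t₀ = a • t₀ + d • v₀) :
    α ((⇑A.isAnalytification.homeomorph.symm ∘ D.unif) (Matrix.of (Matrix.of g * Matrix.of b) *ᵥ v₀))
        (fun _ ↦ mfderiv 𝓘(ℝ, Fin (p + 1) → ℂ) 𝓘(ℝ, A.model) (⇑A.isAnalytification.homeomorph.symm ∘ D.unif)
          (Matrix.of (Matrix.of g * Matrix.of b) *ᵥ v₀) (Matrix.of (Matrix.of g * Matrix.of b) *ᵥ t₀)) =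
      (a * k⁻¹) * α ((⇑A.isAnalytification.homeomorph.symm ∘ D.unif) (Matrix.of g *ᵥ v₀))
        (fun _ ↦ mfderiv 𝓘(ℝ, Fin (p + 1) → ℂ) 𝓘(ℝ, A.model) (⇑A.isAnalytification.homeomorph.symm ∘ D.unif)
          (Matrix.of g *ᵥ v₀) (Matrix.of g *ᵥ t₀)) :=
  D.mform₁_coneDeriv_mul_of_mulVec_eq_smul A hα v₀ t₀ hg hk hb hbt

end UnitaryBallUniformisationDatum

end Literature.AlgebraicGeometry.ShimuraVarieties
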